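import Mathlib
import Literature.Computability.AlgebraicComplexity.ValiantClasses
import Literature.Computability.AlgebraicComplexity.StandardFamilies
import HarnessLib
import HarnessLib.Audit

/-!
# The τ-conjecture for Newton polygons (Koiran–Portier–Tavenas–Thomassé 2015): the conjecture,
# its weak form, the transfer theorem to the permanent, and the convexity upper bounds

Topic `Literature/Computability/AlgebraicComplexity`. Source: P. Koiran, N. Portier, S. Tavenas,
S. Thomassé, *A τ-conjecture for Newton polygons*, Found. Comput. Math. 15 (2015) 185–197
(arXiv:1308.2286), §2 and §4 — read in full this session (materialised text). Contents:

* `newtonVertexCount f` — the number of vertices of the Newton polygon `Newt(f)` of a bivariate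
  polynomial (`= conv(Mon(f))`, §2), typed as the number of extreme points of the convex hull in
  `ℝ²` of the support; KPTT count EDGES, which for a polygon with ≥ 3 vertices is the same number
  (and is ≤ the vertex count + 0 otherwise: a segment has 2 vertices, a point 1).
* `KPTT.newtonTauConjecture` — Conjecture 1 ("τ-conjecture for Newton polygons"): a bound
  `p(kmt)` on the number of edges of `Newt(Σ_{i≤k} Π_{j≤m} f_ij)` for `t`-sparse `f_ij`. OPEN; a `def`.
* `KPTT.newtonTauWeak` — the weak form singled out after Theorem 1: "an upper bound of the form
  `2^{O(m)}(kt)^{O(1)}` would be sufficient". OPEN; a `def` (it is the target `NewtonTauWeak` of route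
  `Summit.ValiantsHypothesis.ValiantsHypothesis.Theses.NewtonUnitEquations`, verbatim).
* `KPTT.theorem1` — Theorem 1 in the weak-form instance: the weak bound implies that the permanent
  is not computable by polynomial-size arithmetic circuits (over a field of characteristic `0`;
  Remark 1: any characteristic `≠ 2`), here over `ℂ` as `¬ IsVPFamily (per_n)` (the permanent has
  degree `n`, so "polynomial size" = `VP`-membership of the family). Named fact (theorem in print;
  it is the support item `KpttTransfer` of the route above, verbatim).
* `KPTT.theorem5`, `KPTT.theorem6` — the upper bounds from convex geometry (Eisenbrand–Pach–
  Rothvoß–Sopher): `Newt(Σ_{i≤k} f_i g_i)` has `O(k(r^{2/3}s^{2/3} + r + s))` edges for `r`-sparse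
  `f_i`, `s`-sparse `g_i` (Thm 5), and `Newt(Σ_{i≤k} Π_{j≤m} f_ij)` has `O(k·t^{2m/3})` edges for
  `m ≥ 2` (Thm 6); valid over any field (§4: "These results apply to fields of arbitrary
  characteristic"). Named facts.

Not recorded: Prop. 1 (`M_m(t) ≥ t^{m/3} - 1`, the limit of the convexity method), Thms 2–3
(the refined transfer with exponent `c < 2`), the appendix Thm 7 (`fg + 1` with equal supports).

## Open statements (provefact verdict 2026-08-15)

`KPTT.newtonTauConjecture` and `KPTT.newtonTauWeak` are OPEN PROBLEMS registered as statements
(CONVENTIONS §4: `def … : Prop`, docstring `OPEN CONJECTURE — … [status: open]`), not named-fact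
debt: no `_holds` theorem is to be expected for either, and users keep them as explicit hypotheses
(`KPTT.theorem1` consumes `newtonTauWeak`; route NewtonUnitEquations mirrors it as its target).
Status as printed: KPTT pose Conjecture 1 (§2) and assert only that the weak bound *would suffice*
for Theorem 1 ("For instance, an upper bound of the form `2^{O(m)}(kt)^{O(1)}` would be
sufficient"); §5 (Final Remarks) lists even the `k = 2` case as open ("what is the maximum number
of edges on the Newton polygon of `f_1 … f_m + 1` …? Theorem 6 provides a `O(t^{2m/3})` upper
bound, but the true bound could be of the form `2^{O(m)} t^{O(1)}`"). Still open in 2023: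
Chatterjee–Gajjar–Tengse restate it as their Conjecture 1.3 ("fairly strong … implies, among other
things, that `VP ≠ VNP` … believed to be false"; Hrubeš–Yehudayoff's shadows of Newton polytopes
are "an approach to refute" it) [ChatterjeeGajjarTengse2022, §1, Conjecture 1.3]. The tree proves
`newtonTauConjecture → newtonTauWeak` (`KPTT.newtonTauWeak_of_newtonTauConjecture`, sibling file
`NewtonPolygonTauProofs`). Names are kept (both have users); statements unchanged.

## References

* P. Koiran, N. Portier, S. Tavenas, S. Thomassé, Found. Comput. Math. 15 (2015) 185–197,
  arXiv:1308.2286: Conjecture 1, Theorem 1 and the sentence following it, Remark 1, Theorems 5–6,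
  §5 Final Remarks [KoiranPortierTavenasThomasse2015].
* P. Chatterjee, K. Gajjar, A. Tengse, *Monotone Classes Beyond VNP*, FSTTCS 2023 (LIPIcs),
  arXiv:2202.13103, §1 Conjecture 1.3 (status of the KPTT conjecture) [ChatterjeeGajjarTengse2022].
-/

noncomputable section

namespace Literature.Computability.AlgebraicComplexity

open scoped BigOperators

universe u

/-- The number of vertices of the Newton polygon of a bivariate polynomial `f` (KPTT 2015, §2:
`Newt(f) = conv(Mon(f))`, `Mon(f) ⊆ ℕ²` the support): the number of extreme points of the convex
hull in `ℝ²` of the image of `f.support`. (KPTT count edges; equal to the number of vertices for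
a genuine polygon.) [cite: KoiranPortierTavenasThomasse2015, §2] -/
abbrev newtonVertexCount {k : Type u} [CommSemiring k] (f : MvPolynomial (Fin 2) k) : ℕ :=
  (Set.extremePoints ℝ (convexHull ℝ ((fun e : Fin 2 →₀ ℕ => fun i : Fin 2 => ((e i : ℕ) : ℝ)) ''
    (f.support : Set (Fin 2 →₀ ℕ))))).ncard

namespace KPTT

/-- OPEN CONJECTURE — **Conjecture 1 of KPTT 2015 (τ-conjecture for Newton polygons), over `ℂ`.**
Printed: "There is a polynomial `p` such that the following property holds. Consider any bivariate
polynomial `f ∈ 𝕂[X,Y]` of the form `f(X,Y) = Σ_{i=1}^k Π_{j=1}^m f_ij(X,Y)` where the `f_ij` have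
at most `t` monomials. Then the Newton polygon of `f` has at most `p(kmt)` edges." Recorded with
the polynomial as `(kmt + 2)^C` and vertices for edges. POSED, not proved (KPTT §2; §5 lists its
simplest instances as open problems; restated as open — and "believed to be false" — in
Chatterjee–Gajjar–Tengse 2023, Conjecture 1.3): a `Prop`, never asserted, no `_holds` expected;
users take `(h : newtonTauConjecture)`. It implies `newtonTauWeak`
(`newtonTauWeak_of_newtonTauConjecture` in `NewtonPolygonTauProofs`).
[cite: KoiranPortierTavenasThomasse2015, Conjecture 1] [status: open] -/
@[conjecture] def newtonTauConjecture : Prop :=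
  ∃ C : ℕ, ∀ (k m t : ℕ) (f : Fin k → Fin m → MvPolynomial (Fin 2) ℂ),
    (∀ i j, (f i j).support.card ≤ t) →
      newtonVertexCount (∑ i, ∏ j, f i j) ≤ (k * m * t + 2) ^ C

/-- OPEN CONJECTURE — **the weak form of the Newton-polygon τ-conjecture (KPTT 2015, sentence
after Theorem 1).** Printed: "For instance, an upper bound of the form `2^{O(m)}(kt)^{O(1)}` would
be sufficient [for the conclusion of Theorem 1]." Recorded as: there are constants `a, b` with
`#vertices Newt(Σ_{i<k} Π_{j<m} f_ij) ≤ 2^{a·m}·(kt + 2)^b` for all `t`-sparse bivariate `f_ij`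
over `ℂ` (verbatim the target `NewtonTauWeak` of route NewtonUnitEquations). POSED as the
sufficient HYPOTHESIS of Theorem 1, never asserted by KPTT; §5 (Final Remarks) lists even its
`k = 2` case as open ("the true bound could be of the form `2^{O(m)} t^{O(1)}`"), the known bounds
being `k·t^m` (trivial), `kmt` without cancellations (§2) and `O(k·t^{2m/3})` (Theorem 6), none
with a `t`-exponent independent of `m`; no proof or counterexample is in print (Chatterjee–Gajjar–
Tengse 2023, Conjecture 1.3 and the discussion after it). By `theorem1` a proof would put the
permanent outside `VP`. A `Prop`, no `_holds` expected; users take `(h : newtonTauWeak)`.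
[cite: KoiranPortierTavenasThomasse2015, Theorem 1 (remark following it); §5] [status: open] -/
@[conjecture] def newtonTauWeak : Prop :=
  ∃ a b : ℕ, ∀ (k m t : ℕ) (f : Fin k → Fin m → MvPolynomial (Fin 2) ℂ),
    (∀ i j, (f i j).support.card ≤ t) →
      newtonVertexCount (∑ i, ∏ j, f i j) ≤ 2 ^ (a * m) * (k * t + 2) ^ b

/-- **KPTT 2015, Theorem 1 (weak-form instance): the Newton-polygon τ-conjecture implies that the
permanent is hard.** Printed: "Assume that for some universal constant `c < 2`, the upper bound
`2^{(m + log kt)^c}` on the number of edges of `Newt(f)` holds true for polynomials of the form (1)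
whenever the product `kmt` is sufficiently large. Then the permanent is not computable by polynomial
size arithmetic circuits. — For instance, an upper bound of the form `2^{O(m)}(kt)^{O(1)}` would be
sufficient." (Field of characteristic `0`; Remark 1: any characteristic `≠ 2`.) Recorded over `ℂ`
with the "for instance" hypothesis `newtonTauWeak` and the conclusion that `(per_n)_n` is not a
`VP` family (`IsVPFamily`, `perPoly`; the permanent has degree `n`, so polynomial size is the whole
content). The proof (§3) goes through reduction to depth four (Koiran 2012 / Tavenas) applied to the
witness `Σ_{i<2ⁿ} X^i Y^{2i(2ⁿ-1-i)}`, a projection of the permanent with `2ⁿ` hull vertices. Named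
fact (D-0014); it is the support item `KpttTransfer` of route NewtonUnitEquations verbatim.
[cite: KoiranPortierTavenasThomasse2015, Theorem 1] -/
def theorem1 : Prop :=
  newtonTauWeak → ¬ IsVPFamily (fun n => perPoly (Fin n) ℂ)

/-- **KPTT 2015, Theorem 5 (sums of products of two sparse polynomials).** Printed: "Consider a
bivariate polynomial `f ∈ 𝕂[X,Y]` of the form `f(X,Y) = Σ_{i=1}^k f_i g_i(X,Y)` where the `f_i` have
at most `r` monomials and the `g_i` have at most `s` monomials. The Newton polygon of `f` has
`O(k(r^{2/3}s^{2/3} + r + s))` edges." (Any field, §4; via Eisenbrand–Pach–Rothvoß–Sopher 2008.)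
Recorded with an absolute constant `C` and the vertex count. [cite: KoiranPortierTavenasThomasse2015, Theorem 5] -/
def theorem5 : Prop :=
  ∃ C : ℝ, ∀ (K : Type) [Field K] (k r s : ℕ) (f g : Fin k → MvPolynomial (Fin 2) K),
    (∀ i, (f i).support.card ≤ r) → (∀ i, (g i).support.card ≤ s) →
      (newtonVertexCount (∑ i, f i * g i) : ℝ) ≤
        C * k * ((r : ℝ) ^ (2 / 3 : ℝ) * (s : ℝ) ^ (2 / 3 : ℝ) + r + s)

/-- **KPTT 2015, Theorem 6 (sums of products of `m ≥ 2` sparse polynomials).** Printed: "Consider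
any bivariate polynomial `f ∈ 𝕂[X,Y]` of the form `f(X,Y) = Σ_{i=1}^k Π_{j=1}^m f_ij(X,Y)` where
`m ≥ 2` and the `f_ij` have at most `t` monomials. The Newton polygon of `f` has `O(k·t^{2m/3})`
edges." (Any field, §4; split each product into two halves and apply Theorem 5.) Recorded with an
absolute constant `C` and the vertex count. [cite: KoiranPortierTavenasThomasse2015, Theorem 6] -/
def theorem6 : Prop :=
  ∃ C : ℝ, ∀ (K : Type) [Field K] (k m t : ℕ) (f : Fin k → Fin m → MvPolynomial (Fin 2) K),
    2 ≤ m → (∀ i j, (f i j).support.card ≤ t) →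
      (newtonVertexCount (∑ i, ∏ j, f i j) : ℝ) ≤ C * k * (t : ℝ) ^ (2 * (m : ℝ) / 3)

end KPTT

end Literature.Computability.AlgebraicComplexity
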